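import Summits.AtomisticToContinuum.Crystallization.Theorems.OverbindingBudgetTightDozen
import Summits.AtomisticToContinuum.Crystallization.Theorems.OverbindingBudgetPeriodicCleanOrStrained

/-!
# OverbindingBudget — E_per on the layered model reduces to the RIGIDITY OF BALANCED LAYERED CLEAN NASH CONFIGURATIONS (lens-4 g28, part XIII)

Helper file (`--supports stmt-AtomisticToContinuum-31280`).  Part X moved the periodic-branch piece E_per onto `LayeredCleanOrStrained Λ T₀ D`
(an `L_opt`-class texture of the form `Layered a b w` is uniformly clean or strained).  This file strips E_per of everything the cone already
pays for elsewhere and leaves ONE statement in lens-3's layered vocabulary with NO texture-class, NO charge, NO optimality and NO limit in it: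

* **`BalancedLayeredClean Λ`** (§1) — a `δ`-separated layered configuration `Layered a b w` (independent in-plane periods of norm `≤ Λ`) which
  is two-shell clean (N's `IsClean`), single-site Nash (N's `IsNash`), virial-balanced and stress-free (the dilation and shear tests of
  `…ElasticSplitDilation` / `…ElasticSplitShear` pass at every volume rate) is UNIFORMLY CLEAN.  [= the homogeneous-strain plan of memo §9 rolled
  into one node: LayerStructure (1a) ∧ HollowSelection over lens-3's D1 `NashBalance` (1b′) ∧ CellConvexity (1c); UNDECIDED·TRUE-type for
  `V_LJ` (equilibrium Barlow stackings have all twelve contacts within `2·10⁻⁴` of `a_eq ≈ 0.9712 ∈ [47/50, 1]`, next shell at `√2·a_eq >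
  1.26·a_eq`; a second stress-free critical point inside the `1/16` clean window is excluded by cell convexity, census TAG 141);
  ATTACKABLE·L·CERT (LJ lattice sums with interval arithmetic).] [piece]
* `layeredCleanOrStrained_of_balanced` (§2, PROVED, `T₀ ≤ 1/2`): `CleanTwoShell T₀ D → BalancedLayeredClean Λ → LayeredCleanOrStrained Λ T₀ D`
  — the seams are all in the tree: `unstrained_or_strained` (case split), `CleanTwoShell` + `isClean_μS_iff` (N's `IsClean`),
  `isNash_of_locallyOptimal` (N's `IsNash`), `virialBalanced_of_unstrained` / `stressFree_of_unstrained` (the strain tests), `sep_of_cleanClass`.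
* CONE `rdef_of_grossU_doorPeriodic_balanced Λ` (§2): `GrossCleanBallsU (1/250) 10 → ChargedEnergyGap → CompressedVirialLaw (1/250) 10 →
  TightDozenRigidity (1/250) → CleanCharted (1/250) 10 → DoorPeriodic Λ → BalancedLayeredClean Λ → CleanlessExcessT → CoherentResidual 10 →
  RobustDefectLimitWindows` — B₁ (`CleanTwoShell (1/250) 10`, derived from slot 4 through parts IXa/IXb/XI/XII) is used TWICE: by the door bridge
  and by the E_per seam.  NINTH cone form; every slot but `DoorPeriodic Λ` (N, shared) and the two census/certificate leaves is now a statement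
  about finite or exactly periodic configurations.
-/

namespace Summit.AtomisticToContinuum.Crystallization.Theorems.OverbindingBudgetBalancedLayered

open Summit.AtomisticToContinuum.Crystallization.Theses.OverbindingBudget (RobustDefectLimitWindows)
open Summit.AtomisticToContinuum.Crystallization.Theses.PricedLinkCensus (ChargedEnergyGap)
open Summit.AtomisticToContinuum.Crystallization.Theorems.OverbindingBudgetGradedBareness (CleanlessExcessT)
open Summit.AtomisticToContinuum.Crystallization.Theorems.OverbindingBudgetCoherentCut (CoherentResidual)
open Summit.AtomisticToContinuum.Crystallization.Theorems.OverbindingBudgetUniformCutStatements (GrossCleanBallsU)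
open Summit.AtomisticToContinuum.Crystallization.Theorems.OverbindingBudgetEdgeRelaxationStatements (CleanClass StrainedCubes)
open Summit.AtomisticToContinuum.Crystallization.Theorems.OverbindingBudgetElasticSplitStatements (SparseCharge LocallyOptimal VirialBalanced)
open Summit.AtomisticToContinuum.Crystallization.Theorems.OverbindingBudgetElasticSplitScale (HasCompressedScale CompressedVirialLaw)
open Summit.AtomisticToContinuum.Crystallization.Theorems.OverbindingBudgetElasticSplitShear (StressFree)
open Summit.AtomisticToContinuum.Crystallization.Theorems.OverbindingBudgetElasticSplitPeriodic (Unstrained unstrained_or_strained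
  virialBalanced_of_unstrained stressFree_of_unstrained)
open Summit.AtomisticToContinuum.Crystallization.Theorems.OverbindingBudgetElasticSplitDoorBridge (CleanTwoShell CleanCharted isClean_μS_iff)
open Summit.AtomisticToContinuum.Crystallization.Theorems.OverbindingBudgetLiouvilleDictionary (isNash_of_locallyOptimal)
open Summit.AtomisticToContinuum.Crystallization.Theorems.ChartedPlanarOrderRigidityDoor (IsClean IsNash)
open Summit.AtomisticToContinuum.Crystallization.Theorems.ChartedPlanarOrderDensityDichotomy (μS IsSep)
open Summit.AtomisticToContinuum.Crystallization.Theorems.ChartedPlanarOrderDoorLayered (Layered DoorPeriodic)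
open Summit.AtomisticToContinuum.Crystallization.Theorems.OverbindingBudgetTwoShellTransfer (cleanTwoShell_of_ballPieces
  chargeFreeBallRigidity_of_local sep_of_cleanClass)
open Summit.AtomisticToContinuum.Crystallization.Theorems.OverbindingBudgetLimitChargeFreeBall (limitChargeFreeBall_holds)
open Summit.AtomisticToContinuum.Crystallization.Theorems.OverbindingBudgetPeriodicCleanOrStrained (UniformlyClean LayeredCleanOrStrained
  periodicStrainedCubes_of_layered)
open Summit.AtomisticToContinuum.Crystallization.Theorems.OverbindingBudgetTightDozen (TightDozenRigidity localTwoShellRigidity_of_tight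
  rdef_of_grossU_doorPeriodic_tight)

/-! ## §1 The piece -/

/-- **`BalancedLayeredClean Λ`** — rigidity of balanced layered clean Nash configurations: a `δ`-separated `Layered a b w` (independent
in-plane periods of norm `≤ Λ`) that is two-shell clean, single-site Nash, virial-balanced and stress-free is uniformly clean.
[LayerStructure ∧ HollowSelection (lens-3 D1 `NashBalance`) ∧ CellConvexity; UNDECIDED·TRUE-type; ATTACKABLE·L·CERT.] [piece] -/
def BalancedLayeredClean (Λ : ℝ) : Prop :=
  ∀ δ : ℝ, 0 < δ → ∀ (a b : EuclideanSpace ℝ (Fin 3)) (w : ℤ → EuclideanSpace ℝ (Fin 3)), LinearIndependent ℝ ![a, b] → ‖a‖ ≤ Λ → ‖b‖ ≤ Λ →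
    IsSep δ (Layered a b w) → IsClean (μS (Layered a b w)) → IsNash (μS (Layered a b w)) →
    VirialBalanced (Layered a b w) → StressFree (Layered a b w) → UniformlyClean (Layered a b w)

/-! ## §2 The seam and the cone -/

/-- **Seam, PROVED.** `CleanTwoShell T₀ D → BalancedLayeredClean Λ → LayeredCleanOrStrained Λ T₀ D` (`T₀ ≤ 1/2`). [this file] -/
theorem layeredCleanOrStrained_of_balanced {Λ T₀ D : ℝ} (hT : T₀ ≤ 1 / 2) (h₁ : CleanTwoShell T₀ D) (hB : BalancedLayeredClean Λ) :
    LayeredCleanOrStrained Λ T₀ D := by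
  intro a b w hab ha hb hY hnc hsc hlo
  rcases unstrained_or_strained (Layered a b w) with hU | hS
  · left
    have hδ : (0 : ℝ) < 47 / 50 * (49 / 50) - T₀ := by linarith
    exact hB _ hδ a b w hab ha hb (sep_of_cleanClass hY) ((isClean_μS_iff _).2 (h₁ _ hY hnc hsc hlo hU)) (isNash_of_locallyOptimal hlo)
      (virialBalanced_of_unstrained hU) (stressFree_of_unstrained hY.1 hU)
  · exact Or.inr hS

/-- **RDEF cone, ninth form** (every `Λ`): `GrossCleanBallsU (1/250) 10 → ChargedEnergyGap → CompressedVirialLaw (1/250) 10 →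
TightDozenRigidity (1/250) → CleanCharted (1/250) 10 → DoorPeriodic Λ → BalancedLayeredClean Λ → CleanlessExcessT → CoherentResidual 10 →
RobustDefectLimitWindows`; B₁ is derived once from slot 4 and used by both the door bridge and the E_per seam. [this file] -/
theorem rdef_of_grossU_doorPeriodic_balanced (Λ : ℝ) (hG : GrossCleanBallsU (1 / 250) 10) (hCEG : ChargedEnergyGap)
    (hC : CompressedVirialLaw (1 / 250) 10) (hK : TightDozenRigidity (1 / 250)) (h₂ : CleanCharted (1 / 250) 10) (hD : DoorPeriodic Λ)
    (hB : BalancedLayeredClean Λ) (hCE : CleanlessExcessT) (hR : CoherentResidual 10) : RobustDefectLimitWindows :=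
  have h₁ : CleanTwoShell (1 / 250) 10 :=
    cleanTwoShell_of_ballPieces (limitChargeFreeBall_holds (1 / 250) 10)
      (chargeFreeBallRigidity_of_local (by norm_num) (localTwoShellRigidity_of_tight (by norm_num) (by norm_num) hK))
  rdef_of_grossU_doorPeriodic_tight Λ hG hCEG hC hK h₂ hD
    (periodicStrainedCubes_of_layered (by norm_num) (layeredCleanOrStrained_of_balanced (by norm_num) h₁ hB)) hCE hR

end Summit.AtomisticToContinuum.Crystallization.Theorems.OverbindingBudgetBalancedLayered
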